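import Summits.BirchSwinnertonDyer.BirchSwinnertonDyer.Theorems.GoldfeldAllTwistsTwoConverseTwinAdditiveCellModel
import Summits.BirchSwinnertonDyer.BirchSwinnertonDyer.Theorems.GoldfeldAllTwistsTwoConverseTwinGenusDescentPartnerTwoExact
import HarnessLib

set_option linter.dupNamespace false -- `…BirchSwinnertonDyer.BirchSwinnertonDyer…` is the cell's namespace (D-0017)
set_option autoImplicit false

/-!
# Twin″ (item 19140), the WHOLE additive cell — uniform local arithmetic, III: the one missing `ℚ₂`-class —
# **`c₂(X₀(49)^{(−24)}) = 4`** on the global minimal model `M_{−6} = [0, 18, 0, −1152, 13824]` (`d ∈ −6·ℚ₂ˣ²`)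

Cell `bsd-goldfeld`, seat `bsd-goldfeld-s1p-c301` (prover, gen 11). Support for item `stmt-BirchSwinnertonDyer-19140`
(crux twin″ `BSDTwoCMSevenAdditiveRankOne`). Theses-free; theorems only; no `sorry`. HONEST FRAMING: local arithmetic
at `2` of ONE explicit curve; nothing about `L`-values; BSD is not proved by any of this and no case of twin″ is claimed.

The additive twists `49a1^{(d)}` (`d` squarefree, `d ≢ 1 (mod 4)`) fall into SIX classes of `ℚ₂ˣ/ℚ₂ˣ²`; `c₂` is constant
on each (seat c301 gen 8 `localTamagawaNumber_padic_quadraticTwist_eq_of_sq`). Five classes have landed certificates with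
`c₂ = 4`: `−4·□` (W₇₈₄, gen 6/8), `−20·□` (E₋₅, gen 8), `−8·□` (W₃₁₃₆, gen 8/9), `−40·□` (E₋₁₀, gen 9), `2·□` (E₂ = 3136⁺,
seat c3 gen 12). This file does the sixth, `d ∈ −6·ℚ₂ˣ² = 10·ℚ₂ˣ²` (`d = 2m`, `m ≡ 5 (mod 8)`; e.g. `d = −6, 10, 26, −38`),
on the representative `X₀(49)^{(−24)} ≅ 49a1^{(−6)}` and its global minimal model `M_{−6} = [0, 18, 0, −1152, 13824]`
(file I `isGloballyMinimal_cellModel` at `d = −6`):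
* `M_{−6}` is an `Iₙ*` normal form over `ℤ₂` (`a₂ = 2·9 ∈ 𝔪 ∖ 𝔪²`, `a₄ = −2⁷·9 ∈ 𝔪³`, `a₆ = 2⁹·27 ∈ 𝔪⁴`), so
  `[J(ℚ₂) : J₀(ℚ₂)] ∈ {2, 4}` (`LocalIndex.index_mem_of_normalForm_Istar_succ`);
* it is `4` by seat c3's full-`2`-torsion device (gen 12, file XIII): `x³ + 18x² − 1152x + 13824 = (x + 48)(x² − 30x + 288)`,
  `x² − 30x + 288 = (x − 15)² + 63`, roots `−48`, `15 ± 3s` with `s² = −7` in `ℤ₂` (`−7 ≡ 1 (mod 8)`; `s` odd), all in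
  `𝔪 = 2ℤ₂`, so the three `ℚ₂`-rational `2`-torsion points reduce to the singular point while `T₁ + T₀ = T₂` — index `2`
  would put them in one non-trivial coset (`index_nonsingularReductionSubgroup_JnegSix`);
* read on the minimal model: **`c₂(X₀(49)^{(−24)}) = 4`** (`localTamagawaNumber_padic_cm7_quadraticTwist_neg_twentyfour`).
File IV (`…TwinAdditiveTamagawaTwoSeven`) assembles `c₂ = 4` on all six classes and `c₇ = 2` on both `ℚ₇`-classes.
Numerics: kit j277601 (PARI `elllocalred`): `49a1^{(−6)}`: Kodaira `I₈*`, `c₂ = 4` (and the same for every squarefree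
`d ≡ 10 (mod 16)`, `|d| ≤ 400`).
References: [Silverman1994] IV.9.4 Step 7, Table 4.1; [SilvermanAEC2009] VII.1, VII.6; [Serre1973] II.3.3 Thm 4; [Kraus1989] Prop. 2.
-/

noncomputable section

open scoped Classical NumberField

open WeierstrassCurve IsDedekindDomain IsLocalRing Rat.HeightOneSpectrum
  Literature.NumberTheory.EllipticCurves Literature.NumberTheory.EllipticCurves.ModularForms
  Literature.NumberTheory.QuadraticForms
  Summit.BirchSwinnertonDyer.BirchSwinnertonDyer.Rank2Observatory.Tate
  Summit.BirchSwinnertonDyer.BirchSwinnertonDyer.Rank2Observatory.RootNumber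

namespace Summit.BirchSwinnertonDyer.BirchSwinnertonDyer.Theorems.GoldfeldGoodTwists

/-! ## The missing `ℚ₂`-class: `c₂(X₀(49)^{(−24)}) = 4` on `M_{−6} = [0, 18, 0, −1152, 13824]` -/

section ClassNegSix

/-- `J ⊗ ℚ₂` is elliptic, `J = M_{−6} = [0, 18, 0, −1152, 13824]` over `ℤ₂` (`Δ = −2¹²·7³·6⁶ ≠ 0`). [folklore] -/
theorem isElliptic_JnegSix :
    ((⟨0, 18, 0, -1152, 13824⟩ : WeierstrassCurve ℤ_[2]).baseChange ℚ_[2]).IsElliptic := by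
  refine ⟨isUnit_iff_ne_zero.mpr ?_⟩
  simp only [WeierstrassCurve.Δ, b₂, b₄, b₆, b₈, baseChange, map_a₁, map_a₂, map_a₃, map_a₄, map_a₆, map_ofNat,
    map_zero, map_neg]
  norm_num

/-- `T₀ = (−48, 0) ∈ J(ℚ₂)` (the rational `2`-torsion point of `M_{−6}`). [folklore] -/
theorem nonsingular_JnegSix_T₀ :
    ((⟨0, 18, 0, -1152, 13824⟩ : WeierstrassCurve ℤ_[2]).baseChange ℚ_[2]).toAffine.Nonsingular
      (algebraMap ℤ_[2] ℚ_[2] (-48)) (algebraMap ℤ_[2] ℚ_[2] 0) := by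
  haveI := isElliptic_JnegSix
  refine (Affine.equation_iff_nonsingular).mp ?_
  rw [Affine.equation_iff']
  simp only [baseChange, toAffine, map_a₁, map_a₂, map_a₃, map_a₄, map_a₆, map_ofNat, map_zero, map_neg]
  norm_num

/-- `T₁ = (15 − 3s, 0) ∈ J(ℚ₂)` for `s² = −7` (`x³ + 18x² − 1152x + 13824 = (x + 48)(x² − 30x + 288)` and
`x² − 30x + 288 = (x − 15)² + 63` vanishes at `x = 15 ± 3s`). [folklore] -/
theorem nonsingular_JnegSix_T₁ {s : ℤ_[2]} (hs : s ^ 2 = -7) :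
    ((⟨0, 18, 0, -1152, 13824⟩ : WeierstrassCurve ℤ_[2]).baseChange ℚ_[2]).toAffine.Nonsingular
      (algebraMap ℤ_[2] ℚ_[2] (15 - 3 * s)) (algebraMap ℤ_[2] ℚ_[2] 0) := by
  haveI := isElliptic_JnegSix
  refine (Affine.equation_iff_nonsingular).mp ?_
  have hs' : ((s : ℚ_[2])) ^ 2 = -7 := by exact_mod_cast congrArg ((↑) : ℤ_[2] → ℚ_[2]) hs
  rw [Affine.equation_iff']
  simp only [baseChange, toAffine, map_a₁, map_a₂, map_a₃, map_a₄, map_a₆, map_ofNat, map_zero, map_sub, map_neg,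
    map_mul, PadicInt.algebraMap_apply]
  linear_combination (27 * (s : ℚ_[2]) - 567) * hs'

/-- `T₂ = (15 + 3s, 0) ∈ J(ℚ₂)` for `s² = −7`. [folklore] -/
theorem nonsingular_JnegSix_T₂ {s : ℤ_[2]} (hs : s ^ 2 = -7) :
    ((⟨0, 18, 0, -1152, 13824⟩ : WeierstrassCurve ℤ_[2]).baseChange ℚ_[2]).toAffine.Nonsingular
      (algebraMap ℤ_[2] ℚ_[2] (15 + 3 * s)) (algebraMap ℤ_[2] ℚ_[2] 0) := by
  haveI := isElliptic_JnegSix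
  refine (Affine.equation_iff_nonsingular).mp ?_
  have hs' : ((s : ℚ_[2])) ^ 2 = -7 := by exact_mod_cast congrArg ((↑) : ℤ_[2] → ℚ_[2]) hs
  rw [Affine.equation_iff']
  simp only [baseChange, toAffine, map_a₁, map_a₂, map_a₃, map_a₄, map_a₆, map_ofNat, map_zero, map_add, map_neg,
    map_mul, PadicInt.algebraMap_apply]
  linear_combination (-(27 * (s : ℚ_[2])) - 567) * hs'

/-- **`T₁ + T₀ = T₂` in `J(ℚ₂)`** (three collinear points on `y = 0`: slope `0`, `x₃ = −a₂ − x₁ − x₀ = 15 + 3s`). [folklore] -/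
theorem T₁_add_T₀_JnegSix {s : ℤ_[2]} (hs : s ^ 2 = -7) :
    (Affine.Point.some _ _ (nonsingular_JnegSix_T₁ hs) :
        ((⟨0, 18, 0, -1152, 13824⟩ : WeierstrassCurve ℤ_[2]).baseChange ℚ_[2]).toAffine.Point) +
      Affine.Point.some _ _ nonsingular_JnegSix_T₀ =
      Affine.Point.some _ _ (nonsingular_JnegSix_T₂ hs) := by
  have hs' : ((s : ℚ_[2])) ^ 2 = -7 := by exact_mod_cast congrArg ((↑) : ℤ_[2] → ℚ_[2]) hs
  have hx : algebraMap ℤ_[2] ℚ_[2] (15 - 3 * s) ≠ algebraMap ℤ_[2] ℚ_[2] (-48) := by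
    intro h0
    have h0' : (15 : ℚ_[2]) - 3 * (s : ℚ_[2]) = -48 := by
      simpa [map_sub, map_ofNat, map_neg, map_mul] using h0
    have h21 : (s : ℚ_[2]) = 21 := by linear_combination h0' / (-3)
    rw [h21] at hs'
    norm_num at hs'
  rw [Affine.Point.add_of_X_ne hx]
  refine point_some_congr ?_ ?_
  · rw [Affine.slope_of_X_ne hx]
    simp only [Affine.addX, baseChange, toAffine, map_a₁, map_a₂, map_ofNat, map_zero, map_sub, map_neg, map_add,
      map_mul, PadicInt.algebraMap_apply]
    ring
  · rw [Affine.addY, Affine.negAddY, Affine.negY, Affine.slope_of_X_ne hx]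
    simp only [Affine.addX, baseChange, toAffine, map_a₁, map_a₂, map_a₃, map_ofNat, map_zero, map_sub, map_neg,
      map_mul, PadicInt.algebraMap_apply]
    ring

/-- For `s² = −7` in `ℤ₂` (`s` odd): `15 − 3s ∈ 𝔪` and `15 + 3s ∈ 𝔪`. [folklore] -/
theorem fifteen_sub_mem_maximalIdeal_of_sq_eq_neg_seven {s : ℤ_[2]} (hs : s ^ 2 = -7) :
    15 - 3 * s ∈ maximalIdeal ℤ_[2] ∧ 15 + 3 * s ∈ maximalIdeal ℤ_[2] := by
  have h : (PadicInt.toZMod s) ^ 2 = PadicInt.toZMod (-7 : ℤ_[2]) := by rw [← map_pow, hs]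
  have h1 : PadicInt.toZMod s = 1 := by
    rw [map_neg, map_ofNat] at h
    revert h; generalize PadicInt.toZMod s = t; revert t; decide
  rw [← PadicInt.ker_toZMod, RingHom.mem_ker, RingHom.mem_ker, map_sub, map_add, map_mul, h1, map_ofNat, map_ofNat]
  exact ⟨by decide, by decide⟩

/-- **`[J(ℚ₂) : J₀(ℚ₂)] = 4` for `J = M_{−6} = [0, 18, 0, −1152, 13824]`** (an `Iₙ*` normal form: `a₂ = 2·9 ∈ 𝔪 ∖ 𝔪²`,
`a₄ = −2⁷·9 ∈ 𝔪³`, `a₆ = 2⁹·27 ∈ 𝔪⁴`, so the index is `2` or `4` by `LocalIndex.index_mem_of_normalForm_Istar_succ`; the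
three `2`-torsion points `T₀ = (−48, 0)`, `T₁ = (15 − 3s, 0)`, `T₂ = T₁ + T₀ = (15 + 3s, 0)`, `s² = −7`, reduce to the
singular point, so index `2` would put `T₀`, `T₁`, `T₁ + T₀` in one non-trivial coset — seat c3's device, gen 12 XIII).
[cite: Silverman1994, IV.9.4 Step 7 and Table 4.1] -/
theorem index_nonsingularReductionSubgroup_JnegSix :
    ((⟨0, 18, 0, -1152, 13824⟩ : WeierstrassCurve ℤ_[2]).nonsingularReductionSubgroup
      (integers_valuationRing_valuation ℤ_[2] ℚ_[2])).index = 4 := by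
  haveI : HenselianLocalRing ℤ_[2] :=
    { is_henselian := fun f hf a₀ h₁ h₂ =>
        HenselianRing.is_henselian (I := IsLocalRing.maximalIdeal ℤ_[2]) f hf a₀ h₁ (h₂.map _) }
  obtain ⟨s, hs⟩ := exists_padicInt_two_sq_eq_neg_seven
  set H := (⟨0, 18, 0, -1152, 13824⟩ : WeierstrassCurve ℤ_[2]).nonsingularReductionSubgroup
    (integers_valuationRing_valuation ℤ_[2] ℚ_[2]) with hH
  have hΔ : (⟨0, 18, 0, -1152, 13824⟩ : WeierstrassCurve ℤ_[2]).Δ ≠ 0 := by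
    simp only [WeierstrassCurve.Δ, b₂, b₄, b₆, b₈]; norm_num
  have h1 : (⟨0, 18, 0, -1152, 13824⟩ : WeierstrassCurve ℤ_[2]).a₁ ∈ maximalIdeal ℤ_[2] := by simp
  have h2 : (⟨0, 18, 0, -1152, 13824⟩ : WeierstrassCurve ℤ_[2]).a₂ ∈ maximalIdeal ℤ_[2] := by
    simpa using natCast_mem_maximalIdeal_padicInt_two (n := 18) (by norm_num)
  have h2' : (⟨0, 18, 0, -1152, 13824⟩ : WeierstrassCurve ℤ_[2]).a₂ ∉ maximalIdeal ℤ_[2] ^ 2 := by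
    have h := (intCast_mem_maximalIdeal_pow_padicInt_two_iff 18 2).not.mpr (by norm_num)
    simpa using h
  have h3 : (⟨0, 18, 0, -1152, 13824⟩ : WeierstrassCurve ℤ_[2]).a₃ ∈ maximalIdeal ℤ_[2] ^ 2 := by simp
  have h4 : (⟨0, 18, 0, -1152, 13824⟩ : WeierstrassCurve ℤ_[2]).a₄ ∈ maximalIdeal ℤ_[2] ^ 3 := by
    have h := (intCast_mem_maximalIdeal_pow_padicInt_two_iff (-1152) 3).mpr (by norm_num)
    simpa using h
  have h6 : (⟨0, 18, 0, -1152, 13824⟩ : WeierstrassCurve ℤ_[2]).a₆ ∈ maximalIdeal ℤ_[2] ^ 4 := by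
    have h := (intCast_mem_maximalIdeal_pow_padicInt_two_iff 13824 4).mpr (by norm_num)
    simpa using h
  rcases LocalIndex.index_mem_of_normalForm_Istar_succ (K := ℚ_[2]) _ hΔ h1 h2 h2' h3 h4 h6 with h | h
  swap
  · exact h
  exfalso
  have h3₁ : (⟨0, 18, 0, -1152, 13824⟩ : WeierstrassCurve ℤ_[2]).a₃ ∈ maximalIdeal ℤ_[2] := by simp
  have h4₁ : (⟨0, 18, 0, -1152, 13824⟩ : WeierstrassCurve ℤ_[2]).a₄ ∈ maximalIdeal ℤ_[2] := by
    have h := (intCast_mem_maximalIdeal_pow_padicInt_two_iff (-1152) 1).mpr (by norm_num)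
    simpa using h
  have h0 : (0 : ℤ_[2]) ∈ maximalIdeal ℤ_[2] := Ideal.zero_mem _
  have h48 : (-48 : ℤ_[2]) ∈ maximalIdeal ℤ_[2] := by
    have h := (intCast_mem_maximalIdeal_pow_padicInt_two_iff (-48) 1).mpr (by norm_num)
    simpa using h
  obtain ⟨hx₁, hx₂⟩ := fifteen_sub_mem_maximalIdeal_of_sq_eq_neg_seven hs
  have hT : (Affine.Point.some _ _ nonsingular_JnegSix_T₀) ∉ H := fun hmem =>
    LocalIndex.not_hasNonsingularReduction_some _ h3₁ h4₁ h48 h0 nonsingular_JnegSix_T₀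
      ((mem_nonsingularReductionSubgroup_iff _).mp hmem)
  have hP : (Affine.Point.some _ _ (nonsingular_JnegSix_T₁ hs)) ∉ H := fun hmem =>
    LocalIndex.not_hasNonsingularReduction_some _ h3₁ h4₁ hx₁ h0 (nonsingular_JnegSix_T₁ hs)
      ((mem_nonsingularReductionSubgroup_iff _).mp hmem)
  have hPT : (Affine.Point.some _ _ (nonsingular_JnegSix_T₂ hs)) ∉ H := fun hmem =>
    LocalIndex.not_hasNonsingularReduction_some _ h3₁ h4₁ hx₂ h0 (nonsingular_JnegSix_T₂ hs)
      ((mem_nonsingularReductionSubgroup_iff _).mp hmem)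
  obtain ⟨a, ha⟩ := AddSubgroup.index_eq_two_iff.mp h
  have key : ∀ P, P ∉ H → P + a ∈ H := fun P hP => by
    rcases ha P with ⟨h', -⟩ | ⟨h', -⟩
    · exact h'
    · exact (hP h').elim
  have ha' : a ∈ H := by
    have e : a = (Affine.Point.some _ _ (nonsingular_JnegSix_T₁ hs) + a) +
        (Affine.Point.some _ _ nonsingular_JnegSix_T₀ + a) -
        (Affine.Point.some _ _ (nonsingular_JnegSix_T₂ hs) + a) := by
      rw [← T₁_add_T₀_JnegSix hs]; abel
    rw [e]
    exact H.sub_mem (H.add_mem (key _ hP) (key _ hT)) (key _ hPT)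
  rcases ha 0 with ⟨-, h'⟩ | ⟨-, h'⟩
  · exact h' H.zero_mem
  · exact h' (by rwa [zero_add])

/-- `M_{−6} ⊗ ℚ ⊗ ℚ₂ = J ⊗ ℚ₂`, `J = [0, 18, 0, −1152, 13824]` over `ℤ₂`. [folklore] -/
theorem cellModel_negSix_baseChange_padic_two :
    ((⟨0, -3 * (-6 : ℤ), 0, -32 * (-6 : ℤ) ^ 2, -64 * (-6 : ℤ) ^ 3⟩ : WeierstrassCurve ℤ).baseChange ℚ).baseChange ℚ_[2] =
      (⟨0, 18, 0, -1152, 13824⟩ : WeierstrassCurve ℤ_[2]).baseChange ℚ_[2] := by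
  ext <;> simp only [baseChange, map_a₁, map_a₂, map_a₃, map_a₄, map_a₆, map_neg, map_mul, map_pow, map_ofNat,
    map_zero, algebraMap_int_eq] <;> norm_num

/-- `−6` is squarefree. [folklore] -/
theorem squarefree_neg_six : Squarefree (-6 : ℤ) := by
  rw [← Int.squarefree_natAbs, show (-6 : ℤ).natAbs = 2 * 3 from rfl]
  exact (Nat.squarefree_mul (by norm_num)).mpr ⟨Nat.prime_two.squarefree, Nat.prime_three.squarefree⟩

/-- `J ⊗ ℚ₂` is a MINIMAL equation over `ℤ₂`: it is `M_{−6} ⊗ ℚ ⊗ ℚ₂`, and `M_{−6}` is globally minimal (file I,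
`isGloballyMinimal_cellModel` at `d = −6`). [cite: Kraus1989, Prop. 2] -/
theorem isMinimal_JnegSix_padic_two :
    ((⟨0, 18, 0, -1152, 13824⟩ : WeierstrassCurve ℤ_[2]).baseChange ℚ_[2]).IsMinimal ℤ_[2] := by
  set w₂ : HeightOneSpectrum (𝓞 ℚ) := (primesEquiv (R := 𝓞 ℚ)).symm ⟨2, Nat.prime_two⟩ with hw₂
  have h2 : ((primesEquiv w₂ : Nat.Primes) : ℕ) = 2 := by rw [hw₂, Equiv.apply_symm_apply]
  have hmin := (isGloballyMinimal_cellModel (d := -6) squarefree_neg_six (by decide)).isMinimal w₂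
  have hmin2 := (isMinimalAt_iff_isMinimal_padic w₂ 2 h2 _).mp hmin
  rw [cellModel_negSix_baseChange_padic_two] at hmin2
  exact hmin2

/-- `X₀(49)^{(−24)} ⊗ ℚ₂ = J ⊗ ℚ₂` along the identity change. [folklore] -/
theorem smul_cm7_quadraticTwist_neg_twentyfour_padic_two :
    (1 : VariableChange ℚ_[2]) • ((cm7.quadraticTwist (-24)).baseChange ℚ_[2]) =
      (⟨0, 18, 0, -1152, 13824⟩ : WeierstrassCurve ℤ_[2]).baseChange ℚ_[2] := by
  rw [one_smul, show (-24 : ℚ) = ((4 * (-6 : ℤ) : ℤ) : ℚ) by norm_num, ← cellModel_baseChange,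
    cellModel_negSix_baseChange_padic_two]

/-- **`c₂(X₀(49)^{(−24)}) = 4`** (Mathlib's `2`-adics) — the `ℚ₂`-class `d ∈ −6·ℚ₂ˣ²` of the additive cell (`d = 2m`,
`m ≡ 5 (mod 8)`), the one class not covered by seats c301/c3's earlier certificates.
[cite: Silverman1994, IV.9.4 Step 7 and Table 4.1] -/
theorem localTamagawaNumber_padic_cm7_quadraticTwist_neg_twentyfour :
    (haveI := cm7.isElliptic_quadraticTwist (show (-24 : ℚ) ≠ 0 by norm_num)
     ((cm7.quadraticTwist (-24)).baseChange ℚ_[2]).localTamagawaNumber ℤ_[2]) = 4 := by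
  haveI := cm7.isElliptic_quadraticTwist (show (-24 : ℚ) ≠ 0 by norm_num)
  haveI := isMinimal_JnegSix_padic_two
  rw [LocalIndex.localTamagawaNumber_eq_index_of_smul_eq_baseChange _ _ _ smul_cm7_quadraticTwist_neg_twentyfour_padic_two]
  exact index_nonsingularReductionSubgroup_JnegSix

end ClassNegSix

end Summit.BirchSwinnertonDyer.BirchSwinnertonDyer.Theorems.GoldfeldGoodTwists

end
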